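import Literature.Computability.Complexity.Williams2014ConvFP
import HarnessLib

/-!
# The `ACC → SYM⁺` conversion is polynomial time on padded codes, II: stages, expansion, output

Continuation of `Williams2014ConvFP.lean` (R. Williams, *Nonuniform ACC circuit lower bounds*,
J. ACM 61 (2014), Lemma 4.1 / Appendix A: the conversion algorithm runs in time
`s^{O(log^{f(d)} s)}`; here: the budgeted conversion `convCodeB` of `Williams2014ConvCap.lean` is in
the typed calculus `CodeFP`). This file derives: the budgeted amplification depth `kapB` and the
capped amplification `todaIterB` (`iterCap`), the stage substitution `substTokB` and the token
strings of all stages `toksB` (unrolled over the constantly many stages), the sorted unions `smerge`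
(a fold bounded by its two arguments), the product `pmul`, one step `stackStep` of the stack machine
and the capped expansion `expandB` (`foldlCap`), the AND-terms with budgeted multiplicities
`termsCodeB`, `sizeCode`, the decoder chain `chainB` / symmetric gate `symOfB`, and finally
**`convCodeB_code`** and **`convOnCodes_code`**: `(code, 1^B) ↦ convCodeB d m B (deserialize' code)`
is computed on codes by a polynomial-time string function.

No new named fact; everything is proved.

## References

* R. Williams, *Nonuniform ACC circuit lower bounds*, J. ACM 61 (2014), Lemma 4.1, Appendix A
  [Williams2014].
* S. Arora, B. Barak, *Computational Complexity: A Modern Approach*, CUP 2009, §1.3, §2.6.2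
  [AroraBarak2009].
-/

noncomputable section

namespace Literature.Computability.Complexity

open _root_.Computability Polynomial CodeFP Brick SatCode

namespace BT

variable {α β γ σ : Type} {eα : α → List Bool} {eβ : β → List Bool} {eγ : γ → List Bool} {eσ : σ → List Bool}

/-! ### Amplification depth and the capped amplification -/

/-- `kapB` on codes: `(1^B, λ) ↦ min B (log₂ (λ^E + 2)) + 1`. [folklore] -/
theorem kapB_code (a e₀ k : ℕ) : CodeFP (pairE unE natE) natE (fun p => kapB p.1 p.2 a e₀ k) := by
  have hB : CodeFP (pairE unE natE) unE (fun p => p.1) := fst _ _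
  have hlam : CodeFP (pairE unE natE) natE (fun p => p.2) := snd _ _
  have hx : CodeFP (pairE unE natE) natE (fun p => p.2 ^ Setup.Eexp a e₀ k + 2) :=
    (natAdd.comp (((natPowConst (Setup.Eexp a e₀ k)).comp hlam).pair (const _ (2 : ℕ)))).congr fun _ => rfl
  have hlog := natLog2Min.comp (hx.pair (replicateUnit.comp hB))
  have h := natAdd.comp (hlog.pair (const _ (1 : ℕ)))
  exact h.congr fun p => by simp [kapB]

/-- **`todaIterB` on codes**: `(1^B, 1^κ, g) ↦ todaIterB B κ g` (a capped iteration). [folklore] -/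
theorem todaIterB_code : CodeFP (pairE unE (pairE unE toksE)) toksE (fun p => todaIterB p.1 p.2.1 p.2.2) := by
  have hf : CodeFP (pairE (pairE unE (pairE unE toksE)) toksE) toksE (fun t => todaToks t.2) := todaToks_code.comp (snd _ _)
  have h := iterCap (σ := ℕ × ℕ × List Tok) (eσ := pairE unE (pairE unE toksE)) (f := fun _ b => todaToks b)
    (init := fun s => s.2.2) (bud := fun s => s.1) (rounds := fun s => s.2.1) ([] : List Tok)
    hf (snd _ _).snd' (fst _ _) (fun s => by rw [pairE_apply, length_boolPair, length_unE]; omega) (snd _ _).fst'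
  exact h.congr fun _ => rfl

/-! ### The stage substitution -/

/-- The context of a stage: `(1^B, μ, T₀, λ, gate codes, depths, table)`. [folklore] -/
abbrev stgCtxE : ℕ × ℕ × ℕ × ℕ × List GateC × List ℕ × List (Bool × WireC) → List Bool :=
  pairE unE (pairE natE (pairE natE (pairE natE (pairE (rawE gateE) (pairE (rawE natE) srcE)))))

/-- `admC m` on codes: `(gate codes, j, q)`. [folklore] -/
theorem admC_code (m : ℕ) : CodeFP (pairE (rawE gateE) (pairE natE natE)) bitE (fun p => admC m p.1 p.2.1 p.2.2) := by
  have hgs : CodeFP (pairE (rawE gateE) (pairE natE natE)) (rawE gateE) (fun p => p.1) := fst _ _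
  have hj : CodeFP (pairE (rawE gateE) (pairE natE natE)) natE (fun p => p.2.1) := (snd _ _).fst'
  have hq : CodeFP (pairE (rawE gateE) (pairE natE natE)) natE (fun p => p.2.2) := (snd _ _).snd'
  have hg : CodeFP (pairE (rawE gateE) (pairE natE natE)) gateE (fun p => p.1.getD p.2.1 (0, [])) :=
    ((rawGetOr gateE).comp (hgs.pair (hj.pair (const _ ((0 : ℕ), ([] : List WireC)))))).congr fun _ => rfl
  have h1 := natLt.comp (hj.pair ((natLength gateE).comp hgs))
  have h2 := (natEq.comp (hg.fst'.pair (const _ (0 : ℕ)))).not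
  have h3 := (natEq.comp (hq.pair (const _ (0 : ℕ)))).or ((mem natE_injective).comp (hq.pair (const _ (primesL m))))
  exact ((h1.and h2).and h3).congr fun p => by
    simp only [admC, mem_primesL]

/-- `levC m` on codes: `(depths, j, q)`. [folklore] -/
theorem levC_code (m : ℕ) : CodeFP (pairE (rawE natE) (pairE natE natE)) natE (fun p => levC m p.1 p.2.1 p.2.2) := by
  have hds : CodeFP (pairE (rawE natE) (pairE natE natE)) (rawE natE) (fun p => p.1) := fst _ _
  have hj : CodeFP (pairE (rawE natE) (pairE natE natE)) natE (fun p => p.2.1) := (snd _ _).fst'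
  have hq : CodeFP (pairE (rawE natE) (pairE natE natE)) natE (fun p => p.2.2) := (snd _ _).snd'
  have hd : CodeFP (pairE (rawE natE) (pairE natE natE)) natE (fun p => p.1.getD p.2.1 0) :=
    ((rawGetD natE (d := 0) rfl).comp (hds.pair hj)).congr fun _ => rfl
  exact (natSub.comp ((natMul.comp ((const _ (m + 1)).pair hd)).pair hq)).congr fun _ => rfl

/-- **`substTokB` on codes** (stage context, token), for numerals `m a e₀ Lmax k`. [folklore] -/
theorem substTokB_code (m a e₀ Lmax k : ℕ) : CodeFP (pairE stgCtxE tokE) toksE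
    (fun p => substTokB p.1.1 m p.1.2.1 p.1.2.2.1 p.1.2.2.2.1 a e₀ Lmax k p.1.2.2.2.2.1 p.1.2.2.2.2.2.1 p.1.2.2.2.2.2.2 p.2) := by
  have hB : CodeFP (pairE stgCtxE tokE) unE (fun p => p.1.1) := (fst _ _).fst'
  have hmu : CodeFP (pairE stgCtxE tokE) natE (fun p => p.1.2.1) := (fst _ _).snd'.fst'
  have hT₀ : CodeFP (pairE stgCtxE tokE) natE (fun p => p.1.2.2.1) := (fst _ _).snd'.snd'.fst'
  have hlam : CodeFP (pairE stgCtxE tokE) natE (fun p => p.1.2.2.2.1) := (fst _ _).snd'.snd'.snd'.fst'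
  have hgs : CodeFP (pairE stgCtxE tokE) (rawE gateE) (fun p => p.1.2.2.2.2.1) := (fst _ _).snd'.snd'.snd'.snd'.fst'
  have hds : CodeFP (pairE stgCtxE tokE) (rawE natE) (fun p => p.1.2.2.2.2.2.1) := (fst _ _).snd'.snd'.snd'.snd'.snd'.fst'
  have hsrc : CodeFP (pairE stgCtxE tokE) srcE (fun p => p.1.2.2.2.2.2.2) := (fst _ _).snd'.snd'.snd'.snd'.snd'.snd'
  have htup : CodeFP (pairE stgCtxE tokE) tupE (fun p => tokTuple p.2) := (tokTuple_code.comp (snd _ _)).congr fun _ => rfl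
  have htag : CodeFP (pairE stgCtxE tokE) natE (fun p => (tokTuple p.2).1) := htup.fst'
  have hc : CodeFP (pairE stgCtxE tokE) natE (fun p => (tokTuple p.2).2.1) := htup.snd'.fst'
  have hj : CodeFP (pairE stgCtxE tokE) natE (fun p => (tokTuple p.2).2.2.1) := htup.snd'.snd'.fst'
  have hq : CodeFP (pairE stgCtxE tokE) natE (fun p => (tokTuple p.2).2.2.2.1) := htup.snd'.snd'.snd'.fst'
  have hadm := (admC_code m).comp (hgs.pair (hj.pair hq))
  have hlev := natEq.comp ((((levC_code m).comp (hds.pair (hj.pair hq)))).pair (const _ (Lmax - k)))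
  have hff : CodeFP (pairE stgCtxE tokE) toksE (fun p => ffToksB p.1.1 m p.1.2.1 p.1.2.2.1 p.1.2.2.2.2.1 p.1.2.2.2.2.2.2
      (tokTuple p.2).2.1 (tokTuple p.2).2.2.1 (tokTuple p.2).2.2.2.1) :=
    ((ffToksB_code m).comp ((hB.pair (hmu.pair (hT₀.pair (hgs.pair hsrc)))).pair (hc.pair (hj.pair hq)))).congr fun _ => rfl
  have hκ : CodeFP (pairE stgCtxE tokE) unE (fun p => min (kapB p.1.1 p.1.2.2.2.1 a e₀ k) (p.1.1 + 1)) :=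
    (unOfNatMin.comp ((unSucc.comp hB).pair ((kapB_code a e₀ k).comp (hB.pair hlam)))).congr fun _ => rfl
  have hthen : CodeFP (pairE stgCtxE tokE) toksE (fun p => todaIterB p.1.1 (min (kapB p.1.1 p.1.2.2.2.1 a e₀ k) (p.1.1 + 1))
      (powToks (max 2 (stagePrimeC m (Lmax - k)) - 1) (ffToksB p.1.1 m p.1.2.1 p.1.2.2.1 p.1.2.2.2.2.1 p.1.2.2.2.2.2.2
        (tokTuple p.2).2.1 (tokTuple p.2).2.2.1 (tokTuple p.2).2.2.2.1))) :=
    (todaIterB_code.comp (hB.pair (hκ.pair ((powToks_code _).comp hff)))).congr fun _ => rfl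
  have hself : CodeFP (pairE stgCtxE tokE) toksE (fun p => [p.2]) := (rawSingleton tokE).comp (snd _ _)
  have h := (natEq.comp (htag.pair (const _ (1 : ℕ)))).ite ((hadm.and hlev).ite hthen hself) hself
  refine h.congr fun p => ?_
  have hκeq : min (kapB p.1.1 p.1.2.2.2.1 a e₀ k) (p.1.1 + 1) = kapB p.1.1 p.1.2.2.2.1 a e₀ k :=
    min_eq_left (by unfold kapB; omega)
  obtain ⟨s, t⟩ := p
  cases t with
  | inp i => rfl
  | cst z => rfl
  | add => rfl
  | mul => rfl
  | gv c j q =>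
    simp only [tokTuple] at hκeq ⊢
    rw [hκeq]
    simp [substTokB, Bool.and_eq_true, decide_eq_true_eq]

/-- `topToksB` on codes: `(1^B, T, table, output wire)`. [folklore] -/
theorem topToksB_code : CodeFP (pairE unE (pairE natE (pairE srcE wireE))) toksE
    (fun p => topToksB p.1 p.2.1 p.2.2.1 p.2.2.2) := by
  have hB : CodeFP (pairE unE (pairE natE (pairE srcE wireE))) unE (fun p => p.1) := fst _ _
  have hT : CodeFP (pairE unE (pairE natE (pairE srcE wireE))) natE (fun p => p.2.1) := (snd _ _).fst'
  have hsrc : CodeFP (pairE unE (pairE natE (pairE srcE wireE))) srcE (fun p => p.2.2.1) := (snd _ _).snd'.fst'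
  have hout : CodeFP (pairE unE (pairE natE (pairE srcE wireE))) wireE (fun p => p.2.2.2) := (snd _ _).snd'.snd'
  have hlit : CodeFP (pairE (pairE unE (pairE natE (pairE srcE wireE))) natE) toksE
      (fun t => litToksC t.1.2.2.1 t.2 t.1.2.2.2) :=
    (litToksC_code.comp ((hsrc.comp (fst _ _)).pair ((snd _ _).pair (hout.comp (fst _ _))))).congr fun _ => rfl
  have h := sumLToks_code.comp ((map hlit).comp ((CodeFP.id _).pair (rangeOf.comp (hB.pair hT))))
  exact h.congr fun _ => rfl

/-- The context of the token stages: `(1^B, μ, T₀, T, λ, gate codes, depths, table, output wire)`. [folklore] -/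
abbrev tokCtxE : ℕ × ℕ × ℕ × ℕ × ℕ × List GateC × List ℕ × List (Bool × WireC) × WireC → List Bool :=
  pairE unE (pairE natE (pairE natE (pairE natE (pairE natE (pairE (rawE gateE) (pairE (rawE natE) (pairE srcE wireE)))))))

/-- **The token strings of the stages on codes**, for numerals `m a e₀ Lmax` and the stage `k`.
[folklore] -/
theorem toksB_code (m a e₀ Lmax : ℕ) : ∀ k : ℕ, CodeFP tokCtxE toksE (fun x =>
    toksB x.1 m x.2.1 x.2.2.1 x.2.2.2.1 x.2.2.2.2.1 a e₀ Lmax x.2.2.2.2.2.1 x.2.2.2.2.2.2.1 x.2.2.2.2.2.2.2.1 x.2.2.2.2.2.2.2.2 k)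
  | 0 => by
    have hB : CodeFP tokCtxE unE (fun x => x.1) := fst _ _
    have hT : CodeFP tokCtxE natE (fun x => x.2.2.2.1) := (snd _ _).snd'.snd'.fst'
    have hsrc : CodeFP tokCtxE srcE (fun x => x.2.2.2.2.2.2.2.1) := (snd _ _).snd'.snd'.snd'.snd'.snd'.snd'.fst'
    have hout : CodeFP tokCtxE wireE (fun x => x.2.2.2.2.2.2.2.2) := (snd _ _).snd'.snd'.snd'.snd'.snd'.snd'.snd'
    exact (topToksB_code.comp (hB.pair (hT.pair (hsrc.pair hout)))).congr fun _ => rfl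
  | k + 1 => by
    have hB : CodeFP tokCtxE unE (fun x => x.1) := fst _ _
    have hmu : CodeFP tokCtxE natE (fun x => x.2.1) := (snd _ _).fst'
    have hT₀ : CodeFP tokCtxE natE (fun x => x.2.2.1) := (snd _ _).snd'.fst'
    have hlam : CodeFP tokCtxE natE (fun x => x.2.2.2.2.1) := (snd _ _).snd'.snd'.snd'.fst'
    have hgs : CodeFP tokCtxE (rawE gateE) (fun x => x.2.2.2.2.2.1) := (snd _ _).snd'.snd'.snd'.snd'.fst'
    have hds : CodeFP tokCtxE (rawE natE) (fun x => x.2.2.2.2.2.2.1) := (snd _ _).snd'.snd'.snd'.snd'.snd'.fst'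
    have hsrc : CodeFP tokCtxE srcE (fun x => x.2.2.2.2.2.2.2.1) := (snd _ _).snd'.snd'.snd'.snd'.snd'.snd'.fst'
    have hstg : CodeFP tokCtxE stgCtxE (fun x => (x.1, x.2.1, x.2.2.1, x.2.2.2.2.1, x.2.2.2.2.2.1, x.2.2.2.2.2.2.1, x.2.2.2.2.2.2.2.1)) :=
      (hB.pair (hmu.pair (hT₀.pair (hlam.pair (hgs.pair (hds.pair hsrc)))))).congr fun _ => rfl
    have h := (flatten tokE).comp ((map (substTokB_code m a e₀ Lmax k)).comp (hstg.pair (toksB_code m a e₀ Lmax k)))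
    exact h.congr fun x => by rw [toksB, List.flatMap_def]

/-! ### Sorted unions, products and the stack machine -/

/-- The two halves of a split by a key are jointly at most the list. [folklore] -/
theorem length_rawE_filter_add_le (x : ℕ) : ∀ l : List ℕ,
    (rawE natE (l.filter (· < x))).length + (rawE natE (l.filter (x < ·))).length ≤ (rawE natE l).length
  | [] => by simp
  | a :: l => by
    have ih := length_rawE_filter_add_le x l
    simp only [List.filter_cons]
    by_cases h1 : a < x
    · have h2 : ¬ x < a := fun h => lt_asymm h1 h
      simp only [h1, decide_true, h2, decide_false, rawE_cons, length_boolPair, Bool.false_eq_true, ↓reduceIte]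
      omega
    · by_cases h2 : x < a
      · simp only [h1, decide_false, h2, decide_true, rawE_cons, length_boolPair, Bool.false_eq_true, ↓reduceIte]
        omega
      · simp only [h1, h2, decide_false, rawE_cons, length_boolPair, Bool.false_eq_true, ↓reduceIte]
        omega

/-- Inserting costs at most the inserted key. [folklore] -/
theorem length_rawE_sinsert_le (x : ℕ) (l : List ℕ) :
    (rawE natE (sinsert x l)).length ≤ (rawE natE l).length + (2 * (natE x).length + 2) := by
  rw [sinsert, rawE_append, List.length_append, rawE_cons, length_boolPair]
  have := length_rawE_filter_add_le x l
  omega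

/-- The accumulator of `smerge` stays within its two arguments. [folklore] -/
theorem length_rawE_foldl_sinsert_le (l₁ : List ℕ) : ∀ l₂ : List ℕ,
    (rawE natE (l₂.foldl (fun acc x => sinsert x acc) l₁)).length ≤ (rawE natE l₁).length + (rawE natE l₂).length := by
  intro l₂
  induction l₂ using List.reverseRecOn with
  | nil => simp
  | append_singleton l₂ x ih =>
    rw [List.foldl_append, List.foldl_cons, List.foldl_nil, rawE_append, List.length_append]
    have h1 := length_rawE_sinsert_le x (l₂.foldl (fun acc x => sinsert x acc) l₁)
    have h2 : (rawE natE [x]).length = 2 * (natE x).length + 2 := by simp [rawE_cons]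
    omega

/-- `sinsert` on codes: `(x, l)`. [folklore] -/
theorem sinsert_code : CodeFP (pairE natE (rawE natE)) (rawE natE) (fun p => sinsert p.1 p.2) := by
  have hlt : CodeFP (pairE natE natE) bitE (fun t => decide (t.2 < t.1)) := natLt.comp ((snd _ _).pair (fst _ _))
  have hgt : CodeFP (pairE natE natE) bitE (fun t => decide (t.1 < t.2)) := natLt
  have h1 := filter (σ := ℕ) (eσ := natE) hlt
  have h2 := filter (σ := ℕ) (eσ := natE) hgt
  have h := (rawAppend natE).comp (h1.pair ((rawCons natE).comp ((fst _ _).pair h2)))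
  exact h.congr fun _ => rfl

/-- **`smerge` on codes** (a fold whose accumulator is bounded by its two arguments). [folklore] -/
theorem smerge_code : CodeFP (pairE (rawE natE) (rawE natE)) (rawE natE) (fun p => smerge p.1 p.2) := by
  have hstep : CodeFP (pairE (rawE natE) (pairE natE (rawE natE))) (rawE natE) (fun t => sinsert t.2.1 t.2.2) :=
    (sinsert_code.comp (snd _ _)).congr fun _ => rfl
  have h := CodeFP.foldl (σ := List ℕ) (α := ℕ) (β := List ℕ) (eσ := rawE natE) (eα := natE) (eβ := rawE natE)
    (step := fun _ x acc => sinsert x acc) (init := fun l₁ => l₁) hstep (CodeFP.id _) X (fun l₁ p₁ p₂ => by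
      rw [eval_X, pairE_apply, length_boolPair, rawE_append, List.length_append]
      have := length_rawE_foldl_sinsert_le l₁ p₁
      simp only
      omega)
  exact h.congr fun _ => rfl

/-- `pmul` on codes. [folklore] -/
theorem pmul_code : CodeFP (pairE kpolyE kpolyE) kpolyE (fun p => pmul p.1 p.2) := by
  -- inner: context (G, p), item q
  have hq : CodeFP (pairE (pairE kpolyE kmonoE) kmonoE) kmonoE
      (fun t => (t.1.2.1 * t.2.1, smerge t.1.2.2 t.2.2)) :=
    ((intMul.comp ((fst _ _).snd'.fst'.pair (snd _ _).fst')).pair (smerge_code.comp ((fst _ _).snd'.snd'.pair (snd _ _).snd'))).congr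
      fun _ => rfl
  have hrow : CodeFP (pairE kpolyE kmonoE) kpolyE (fun t => t.1.map fun q => (t.2.1 * q.1, smerge t.2.2 q.2)) :=
    ((map hq).comp ((CodeFP.id _).pair (fst _ _))).congr fun _ => rfl
  -- outer: context G, item p
  have h := (flatten kmonoE).comp ((map (σ := KPoly) (eσ := kpolyE) hrow).comp ((snd _ _).pair (fst _ _)))
  exact h.congr fun p => by rw [pmul, List.flatMap_def]

/-- `Nat.pair` on codes. [folklore] -/
theorem natPair_code : CodeFP (pairE natE natE) natE (fun p => Nat.pair p.1 p.2) := by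
  have ha : CodeFP (pairE natE natE) natE (fun p => p.1) := fst _ _
  have hb : CodeFP (pairE natE natE) natE (fun p => p.2) := snd _ _
  have h := natLt.ite (natAdd.comp ((natMul.comp (hb.pair hb)).pair ha))
    (natAdd.comp ((natAdd.comp ((natMul.comp (ha.pair ha)).pair ha)).pair hb))
  exact h.congr fun p => by simp [Nat.pair]

/-- **One step of the stack machine** as a case distinction on the tag of the token and the depth
of the stack. [folklore] -/
theorem stackStep_eq (st : List KPoly) (t : Tok) : stackStep st t =
    if (tokTuple t).1 = 0 then [((1 : ℤ), [2 * (tokTuple t).2.1])] :: st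
    else if (tokTuple t).1 = 1 then
      [((1 : ℤ), [2 * Nat.pair (tokTuple t).2.1 (Nat.pair (tokTuple t).2.2.1 (tokTuple t).2.2.2.1) + 1])] :: st
    else if (tokTuple t).1 = 2 then [((tokTuple t).2.2.2.2, ([] : List ℕ))] :: st
    else if (tokTuple t).1 = 3 then
      (if 2 ≤ st.length then (st.tail.headD [] ++ st.headD []) :: st.tail.tail else st)
    else (if 2 ≤ st.length then pmul (st.tail.headD []) (st.headD []) :: st.tail.tail else st) := by
  rcases st with _ | ⟨G, _ | ⟨F, rest⟩⟩ <;> cases t <;> simp [stackStep, tokTuple]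

/-- **`stackStep` on codes** (stack, token). [folklore] -/
theorem stackStep_code : CodeFP (pairE stackE tokE) stackE (fun p => stackStep p.1 p.2) := by
  have hst : CodeFP (pairE stackE tokE) stackE (fun p => p.1) := fst _ _
  have htup : CodeFP (pairE stackE tokE) tupE (fun p => tokTuple p.2) := (tokTuple_code.comp (snd _ _)).congr fun _ => rfl
  have htag : CodeFP (pairE stackE tokE) natE (fun p => (tokTuple p.2).1) := htup.fst'
  have hc : CodeFP (pairE stackE tokE) natE (fun p => (tokTuple p.2).2.1) := htup.snd'.fst'
  have hj : CodeFP (pairE stackE tokE) natE (fun p => (tokTuple p.2).2.2.1) := htup.snd'.snd'.fst'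
  have hq : CodeFP (pairE stackE tokE) natE (fun p => (tokTuple p.2).2.2.2.1) := htup.snd'.snd'.snd'.fst'
  have hz : CodeFP (pairE stackE tokE) intE (fun p => (tokTuple p.2).2.2.2.2) := htup.snd'.snd'.snd'.snd'
  have hG : CodeFP (pairE stackE tokE) kpolyE (fun p => p.1.headD []) := ((rawHeadD kpolyE (d := []) rfl).comp hst).congr fun _ => rfl
  have hst1 : CodeFP (pairE stackE tokE) stackE (fun p => p.1.tail) := ((rawTail kpolyE).comp hst).congr fun _ => rfl
  have hF : CodeFP (pairE stackE tokE) kpolyE (fun p => p.1.tail.headD []) := ((rawHeadD kpolyE (d := []) rfl).comp hst1).congr fun _ => rfl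
  have hrest : CodeFP (pairE stackE tokE) stackE (fun p => p.1.tail.tail) := ((rawTail kpolyE).comp hst1).congr fun _ => rfl
  have htwo : CodeFP (pairE stackE tokE) bitE (fun p => decide (2 ≤ p.1.length)) :=
    (natLe.comp ((const _ (2 : ℕ)).pair ((natLength kpolyE).comp hst))).congr fun _ => rfl
  have hmono : ∀ {g : List KPoly × Tok → ℤ × List ℕ}, CodeFP (pairE stackE tokE) kmonoE g →
      CodeFP (pairE stackE tokE) stackE (fun p => [g p] :: p.1) := fun hg =>
    ((rawCons kpolyE).comp (((rawSingleton kmonoE).comp hg).pair hst)).congr fun _ => rfl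
  have h0 := hmono (g := fun p => ((1 : ℤ), [2 * (tokTuple p.2).2.1]))
    (((const _ (1 : ℤ)).pair ((rawSingleton natE).comp (natMul.comp ((const _ (2 : ℕ)).pair hc)))).congr fun _ => rfl)
  have h1 := hmono (g := fun p => ((1 : ℤ), [2 * Nat.pair (tokTuple p.2).2.1 (Nat.pair (tokTuple p.2).2.2.1 (tokTuple p.2).2.2.2.1) + 1]))
    (((const _ (1 : ℤ)).pair ((rawSingleton natE).comp (natAdd.comp ((natMul.comp ((const _ (2 : ℕ)).pair
      (natPair_code.comp (hc.pair (natPair_code.comp (hj.pair hq)))))).pair (const _ (1 : ℕ)))))).congr fun _ => rfl)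
  have h2 := hmono (g := fun p => ((tokTuple p.2).2.2.2.2, ([] : List ℕ))) ((hz.pair (const _ ([] : List ℕ))).congr fun _ => rfl)
  have h3 : CodeFP (pairE stackE tokE) stackE (fun p => (p.1.tail.headD [] ++ p.1.headD []) :: p.1.tail.tail) :=
    ((rawCons kpolyE).comp (((rawAppend kmonoE).comp (hF.pair hG)).pair hrest)).congr fun _ => rfl
  have h4 : CodeFP (pairE stackE tokE) stackE (fun p => pmul (p.1.tail.headD []) (p.1.headD []) :: p.1.tail.tail) :=
    ((rawCons kpolyE).comp ((pmul_code.comp (hF.pair hG)).pair hrest)).congr fun _ => rfl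
  have htagEq : ∀ i : ℕ, CodeFP (pairE stackE tokE) bitE (fun p => decide ((tokTuple p.2).1 = i)) := fun i =>
    natEq.comp (htag.pair (const _ i))
  have h := (htagEq 0).ite h0 ((htagEq 1).ite h1 ((htagEq 2).ite h2 ((htagEq 3).ite (htwo.ite h3 hst) (htwo.ite h4 hst))))
  exact h.congr fun p => by rw [stackStep_eq]; simp only [decide_eq_true_eq]

/-- **`expandB` on codes**: `(1^B, tokens) ↦ expandB B tokens` (the capped stack fold, then the top). [folklore] -/
theorem expandB_code : CodeFP (pairE unE toksE) kpolyE (fun p => expandB p.1 p.2) := by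
  have hstep : CodeFP (pairE unE (pairE tokE stackE)) stackE (fun t => stackStep t.2.2 t.2.1) :=
    (stackStep_code.comp ((snd _ _).snd'.pair (snd _ _).fst')).congr fun _ => rfl
  have h := foldlCap (σ := ℕ) (eσ := unE) (step := fun _ t st => stackStep st t) (init := fun _ => ([] : List KPoly))
    (bud := fun B => B) ([] : List KPoly) hstep (const _ []) (CodeFP.id unE) (fun B => by rw [length_unE])
  exact ((rawHeadD kpolyE (d := []) rfl).comp h).congr fun _ => rfl

/-! ### Terms, counts and the symmetric gate -/

/-- `z mod M` on codes through `z - M (z / M)`. [folklore] -/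
theorem intEMod : CodeFP (pairE intE intE) intE (fun p => p.1 % p.2) :=
  (intSub.comp ((fst _ _).pair (intMul.comp ((snd _ _).pair intEDiv)))).congr fun p => by
    show p.1 - p.2 * (p.1 / p.2) = p.1 % p.2
    rw [Int.emod_def]

/-- The multiplicity `(a mod M).toNat` of a keyed monomial: `(M, q)`. [folklore] -/
theorem multOf_code : CodeFP (pairE natE kmonoE) natE (fun p => (p.2.1 % (p.1 : ℤ)).toNat) :=
  (intToNat.comp (intEMod.comp ((snd _ _).fst'.pair (intOfNat.comp (fst _ _))))).congr fun _ => rfl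

/-- **`termsCodeB` on codes**: `(1^B, P, M)`. [folklore] -/
theorem termsCodeB_code : CodeFP (pairE unE (pairE kpolyE natE)) (rawE natE) (fun p => termsCodeB p.1 p.2.1 p.2.2) := by
  -- context (B, M), item q
  have hB : CodeFP (pairE (pairE unE natE) kmonoE) unE (fun t => t.1.1) := (fst _ _).fst'
  have hM : CodeFP (pairE (pairE unE natE) kmonoE) natE (fun t => t.1.2) := (fst _ _).snd'
  have hq : CodeFP (pairE (pairE unE natE) kmonoE) kmonoE (fun t => t.2) := snd _ _
  have hcnt : CodeFP (pairE (pairE unE natE) kmonoE) unE (fun t => min ((t.2.1 % (t.1.2 : ℤ)).toNat) t.1.1) :=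
    (unOfNatMin.comp (hB.pair (multOf_code.comp (hM.pair hq)))).congr fun _ => rfl
  have hitem : CodeFP (pairE (pairE unE natE) kmonoE) (rawE natE) (fun t => t.2.2.length :: t.2.2.map (· / 2)) :=
    ((rawCons natE).comp (((natLength natE).comp hq.snd').pair ((map₀ (natDiv.comp ((CodeFP.id natE).pair
      (const _ (2 : ℕ))))).comp hq.snd'))).congr fun _ => rfl
  have hrep : CodeFP (pairE (pairE unE natE) kmonoE) (rawE natE) (fun t =>
      (List.replicate (min ((t.2.1 % (t.1.2 : ℤ)).toNat) t.1.1) (t.2.2.length :: t.2.2.map (· / 2))).flatten) :=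
    ((flatten natE).comp ((replicateOf (rawE natE)).comp (hitem.pair hcnt))).congr fun _ => rfl
  have hctx : CodeFP (pairE unE (pairE kpolyE natE)) (pairE (pairE unE natE) kpolyE) (fun p => ((p.1, p.2.2), p.2.1)) :=
    ((fst _ _).pair (snd _ _).snd').pair (snd _ _).fst'
  have h := (flatten natE).comp ((map hrep).comp hctx)
  exact h.congr fun p => by rw [termsCodeB, List.flatMap_def]

/-- **`sizeCode` on codes**: `(P, M)`. [folklore] -/
theorem sizeCode_code : CodeFP (pairE kpolyE natE) natE (fun p => sizeCode p.1 p.2) := by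
  have hmult : CodeFP (pairE natE kmonoE) natE (fun t => (t.2.1 % (t.1 : ℤ)).toNat) := multOf_code
  have h := natSum.comp ((map hmult).comp ((snd _ _).pair (fst _ _)))
  exact h.congr fun _ => rfl

/-- `WbB` on codes: `(1^B, λ)`. [folklore] -/
theorem WbB_code (a e₀ k : ℕ) : CodeFP (pairE unE natE) natE (fun p => WbB p.1 p.2 a e₀ k) :=
  (cpow.comp ((fst _ _).pair ((const _ (2 : ℕ)).pair ((natPowConst (Setup.Eexp a e₀ k)).comp (snd _ _))))).congr
    fun _ => rfl

/-- `KfB` on codes: `(1^B, λ)`. [folklore] -/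
theorem KfB_code (a e₀ L : ℕ) : CodeFP (pairE unE natE) natE (fun p => KfB p.1 p.2 a e₀ L) :=
  (natAdd.comp ((natMul.comp ((const _ (2 : ℕ)).pair (WbB_code a e₀ L))).pair (const _ (1 : ℕ)))).congr fun _ => rfl

/-- `MkB` on codes: `(1^B, λ)`. [folklore] -/
theorem MkB_code (m a e₀ Lmax k : ℕ) : CodeFP (pairE unE natE) natE (fun p => MkB p.1 m p.2 a e₀ Lmax k) := by
  have hB : CodeFP (pairE unE natE) unE (fun p => p.1) := fst _ _
  have hinner : CodeFP (pairE unE natE) natE (fun p => 2 ^ min (kapB p.1 p.2 a e₀ k) p.1) :=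
    (cpow.comp (hB.pair ((const _ (2 : ℕ)).pair (kapB_code a e₀ k)))).congr fun _ => rfl
  exact (cpow.comp (hB.pair ((const _ (max 2 (stagePrimeC m (Lmax - k)))).pair hinner))).congr fun _ => rfl

/-- **The decoder chain on codes**: `((1^B, λ), z)`, for numerals `m a e₀ Lmax` and the length `k`. [folklore] -/
theorem chainB_code (m a e₀ Lmax : ℕ) : ∀ k : ℕ,
    CodeFP (pairE (pairE unE natE) intE) intE (fun x => chainB x.1.1 m x.1.2 a e₀ Lmax k x.2)
  | 0 => snd _ _
  | k + 1 => by
    have hctx : CodeFP (pairE (pairE unE natE) intE) (pairE unE natE) (fun x => x.1) := fst _ _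
    have hz : CodeFP (pairE (pairE unE natE) intE) intE (fun x => x.2) := snd _ _
    have hW : CodeFP (pairE (pairE unE natE) intE) intE (fun x => (WbB x.1.1 x.1.2 a e₀ k : ℤ)) :=
      (intOfNat.comp ((WbB_code a e₀ k).comp hctx)).congr fun _ => rfl
    have hM : CodeFP (pairE (pairE unE natE) intE) intE (fun x => (MkB x.1.1 m x.1.2 a e₀ Lmax k : ℤ)) :=
      (intOfNat.comp ((MkB_code m a e₀ Lmax k).comp hctx)).congr fun _ => rfl
    have hD : CodeFP (pairE (pairE unE natE) intE) intE (fun x =>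
        (x.2 + WbB x.1.1 x.1.2 a e₀ k) % (MkB x.1.1 m x.1.2 a e₀ Lmax k : ℤ) - WbB x.1.1 x.1.2 a e₀ k) :=
      (intSub.comp ((intEMod.comp ((intAdd.comp (hz.pair hW)).pair hM)).pair hW)).congr fun _ => rfl
    exact ((chainB_code m a e₀ Lmax k).comp (hctx.pair hD)).congr fun _ => rfl

/-- **`symOfB` on codes**: `((1^B, λ), T, N)`. [folklore] -/
theorem symOfB_code (m a e₀ Lmax : ℕ) : CodeFP (pairE (pairE unE natE) (pairE natE natE)) bitE
    (fun x => symOfB x.1.1 m x.2.1 x.1.2 a e₀ Lmax x.2.2) := by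
  have hctx : CodeFP (pairE (pairE unE natE) (pairE natE natE)) (pairE unE natE) (fun x => x.1) := fst _ _
  have hT : CodeFP (pairE (pairE unE natE) (pairE natE natE)) intE (fun x => (x.2.1 : ℤ)) := intOfNat.comp (snd _ _).fst'
  have hN : CodeFP (pairE (pairE unE natE) (pairE natE natE)) intE (fun x => ((x.2.2 : ℕ) : ℤ)) := intOfNat.comp (snd _ _).snd'
  have hW : CodeFP (pairE (pairE unE natE) (pairE natE natE)) intE (fun x => (WbB x.1.1 x.1.2 a e₀ Lmax : ℤ)) :=
    (intOfNat.comp ((WbB_code a e₀ Lmax).comp hctx)).congr fun _ => rfl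
  have hK : CodeFP (pairE (pairE unE natE) (pairE natE natE)) intE (fun x => (KfB x.1.1 x.1.2 a e₀ Lmax : ℤ)) :=
    (intOfNat.comp ((KfB_code a e₀ Lmax).comp hctx)).congr fun _ => rfl
  have hz : CodeFP (pairE (pairE unE natE) (pairE natE natE)) intE (fun x =>
      ((((x.2.2 : ℕ) : ℤ) + WbB x.1.1 x.1.2 a e₀ Lmax) % (KfB x.1.1 x.1.2 a e₀ Lmax : ℤ) - WbB x.1.1 x.1.2 a e₀ Lmax)) :=
    (intSub.comp ((intEMod.comp ((intAdd.comp (hN.pair hW)).pair hK)).pair hW)).congr fun _ => rfl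
  have hchain := (chainB_code m a e₀ Lmax Lmax).comp (hctx.pair hz)
  have h := intLt.comp (hT.pair (intMul.comp ((const _ (2 : ℤ)).pair hchain)))
  exact h.congr fun _ => rfl

/-! ### The budgeted conversion on codes -/

/-- The size parameter is at most the code length. [folklore] -/
theorem szC_le_length (gs : List GateC) : szC gs ≤ (rawE gateE gs).length := by
  refine max_le (length_le_length_rawE _ _) ?_
  rw [← foldr_max_eq_maxL]
  refine foldr_max_zero_le fun y hy => ?_
  obtain ⟨g, hg, rfl⟩ := List.mem_map.1 hy
  have h1 := length_item_le_length_rawE gateE hg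
  have h2 := length_le_length_rawE wireE g.2
  have h3 : (gateE g).length = 2 * (natE g.1).length + 2 + (rawE wireE g.2).length := by
    show (pairE natE (rawE wireE) g).length = _; rw [pairE_apply, length_boolPair]
  omega

/-- The context of `convCodeB`: `(1^B, n, output wire, gate codes)`. [folklore] -/
abbrev convInE : ℕ × ℕ × WireC × List GateC → List Bool := pairE unE (pairE natE (pairE wireE (rawE gateE)))

/-- **`convCodeB d m` on codes**: `(1^B, n, output wire, gate codes) ↦ convCodeB d m B (n, out, gates)`.
[cite: Williams2014, Lemma 4.1 and Appendix A] -/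
theorem convCodeB_code (d m : ℕ) : CodeFP convInE (rawE natE) (fun x => convCodeB d m x.1 (x.2.1, x.2.2.1, x.2.2.2)) := by
  have hB : CodeFP convInE unE (fun x => x.1) := fst _ _
  have hn : CodeFP convInE natE (fun x => x.2.1) := (snd _ _).fst'
  have hout : CodeFP convInE wireE (fun x => x.2.2.1) := (snd _ _).snd'.fst'
  have hgs : CodeFP convInE (rawE gateE) (fun x => x.2.2.2) := (snd _ _).snd'.snd'
  -- the size parameter and its logarithm
  have hs : CodeFP convInE natE (fun x => szC x.2.2.2) :=
    ((natMax.comp (((natLength gateE).comp hgs).pair (maxL_code.comp ((map₀ ((natLength wireE).comp (snd natE (rawE wireE)))).comp hgs)))).congr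
      fun _ => rfl)
  have hunits : CodeFP convInE (rawE unitE) (fun x => List.replicate (rawE gateE x.2.2.2).length ()) :=
    (replicateUnit.comp (strLength.comp (codeStr hgs))).congr fun _ => rfl
  have hL : CodeFP convInE natE (fun x => Nat.log 2 (szC x.2.2.2)) :=
    (natLog2Min.comp (hs.pair hunits)).congr fun x => by
      show min (List.replicate (rawE gateE x.2.2.2).length ()).length (Nat.log 2 (szC x.2.2.2)) = Nat.log 2 (szC x.2.2.2)
      rw [List.length_replicate]
      exact min_eq_right ((Nat.log_le_self 2 _).trans (szC_le_length _))
  have hlam : CodeFP convInE natE (fun x => Nat.log 2 (szC x.2.2.2) + 2) := (natAdd.comp (hL.pair (const _ (2 : ℕ)))).congr fun _ => rfl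
  have hmu : CodeFP convInE natE (fun x => vvMu (szC x.2.2.2)) := (natAdd.comp (hL.pair (const _ (1 : ℕ)))).congr fun _ => rfl
  have hR : CodeFP convInE natE (fun x => vvR (szC x.2.2.2)) := (natMul.comp ((const _ (6 : ℕ)).pair hlam)).congr fun _ => rfl
  have hK : CodeFP convInE natE (fun x => vvK (szC x.2.2.2)) := (natAdd.comp (hmu.pair (const _ (2 : ℕ)))).congr fun _ => rfl
  have hT₀ : CodeFP convInE natE (fun x => vvT₀ (szC x.2.2.2)) :=
    (natMul.comp (hR.pair (natAdd.comp (hK.pair (const _ (1 : ℕ)))))).congr fun _ => rfl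
  have hbits : CodeFP convInE natE (fun x => vvBits (szC x.2.2.2)) :=
    (natMul.comp (hR.pair (natMul.comp (hK.pair (natAdd.comp (hmu.pair (const _ (1 : ℕ)))))))).congr fun _ => rfl
  have hT : CodeFP convInE natE (fun x => 2 ^ min (vvBits (szC x.2.2.2)) x.1) :=
    (cpow.comp (hB.pair ((const _ (2 : ℕ)).pair hbits))).congr fun _ => rfl
  -- tables and the token string of the last stage
  have hds : CodeFP convInE (rawE natE) (fun x => depthsC x.2.2.2) := depthsC_code.comp hgs
  have hsrc : CodeFP convInE srcE (fun x => srcTableC x.2.2.2) := srcTableC_code.comp hgs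
  have hctx : CodeFP convInE tokCtxE (fun x => (x.1, vvMu (szC x.2.2.2), vvT₀ (szC x.2.2.2), 2 ^ min (vvBits (szC x.2.2.2)) x.1,
      Nat.log 2 (szC x.2.2.2) + 2, x.2.2.2, depthsC x.2.2.2, srcTableC x.2.2.2, x.2.2.1)) :=
    (hB.pair (hmu.pair (hT₀.pair (hT.pair (hlam.pair (hgs.pair (hds.pair (hsrc.pair hout)))))))).congr fun _ => rfl
  have htoks := (toksB_code m (4 * m + 10) 7 ((m + 1) * d) ((m + 1) * d)).comp hctx
  have hP : CodeFP convInE kpolyE (fun x => expandB x.1 (toksB x.1 m (vvMu (szC x.2.2.2)) (vvT₀ (szC x.2.2.2))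
      (2 ^ min (vvBits (szC x.2.2.2)) x.1) (Nat.log 2 (szC x.2.2.2) + 2) (4 * m + 10) 7 ((m + 1) * d) x.2.2.2
      (depthsC x.2.2.2) (srcTableC x.2.2.2) x.2.2.1 ((m + 1) * d))) :=
    (expandB_code.comp (hB.pair htoks)).congr fun _ => rfl
  have hM : CodeFP convInE natE (fun x => KfB x.1 (Nat.log 2 (szC x.2.2.2) + 2) (4 * m + 10) 7 ((m + 1) * d)) :=
    ((KfB_code (4 * m + 10) 7 ((m + 1) * d)).comp (hB.pair hlam)).congr fun _ => rfl
  have hsize := sizeCode_code.comp (hP.pair hM)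
  have hterms := termsCodeB_code.comp (hB.pair (hP.pair hM))
  -- the table of the symmetric gate
  have hsym : CodeFP (pairE convInE natE) bitE (fun t => symOfB t.1.1 m (2 ^ min (vvBits (szC t.1.2.2.2)) t.1.1)
      (Nat.log 2 (szC t.1.2.2.2) + 2) (4 * m + 10) 7 ((m + 1) * d) t.2) :=
    ((symOfB_code m (4 * m + 10) 7 ((m + 1) * d)).comp ((((hB.pair hlam).comp (fst _ _))).pair
      ((hT.comp (fst _ _)).pair (snd _ _)))).congr fun _ => rfl
  have hentry := hsym.ite (const _ (eβ := natE) (1 : ℕ)) (const _ (eβ := natE) (0 : ℕ))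
  have hrange : CodeFP convInE (rawE natE) (fun x => List.range (min (sizeCode (expandB x.1 (toksB x.1 m (vvMu (szC x.2.2.2))
      (vvT₀ (szC x.2.2.2)) (2 ^ min (vvBits (szC x.2.2.2)) x.1) (Nat.log 2 (szC x.2.2.2) + 2) (4 * m + 10) 7 ((m + 1) * d)
      x.2.2.2 (depthsC x.2.2.2) (srcTableC x.2.2.2) x.2.2.1 ((m + 1) * d)))
      (KfB x.1 (Nat.log 2 (szC x.2.2.2) + 2) (4 * m + 10) 7 ((m + 1) * d)) + 1) x.1)) :=
    (rangeOf.comp (hB.pair (natAdd.comp (hsize.pair (const _ (1 : ℕ)))))).congr fun _ => rfl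
  have htable := (map hentry).comp ((CodeFP.id _).pair hrange)
  have h := (rawCons natE).comp (hn.pair ((rawCons natE).comp (hsize.pair ((rawAppend natE).comp (hterms.pair htable)))))
  exact h.congr fun x => by
    simp only [convCodeB]
    rfl

/-- **The conversion on padded codes is polynomial time**: `(code, 1^B) ↦ convCodeB d m B` of the
deserialised code (`deserialize'` of `Williams2014SatInstanceFP.lean`), in the typed calculus `CodeFP`
(hence `∃ f ∈ FP`, by definition of `CodeFP`). [cite: Williams2014, Lemma 4.1 and Appendix A] -/
theorem convOnCodes_code (d m : ℕ) : CodeFP (pairE (listE natE) unE) (listE natE)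
    (fun p => convCodeB d m p.2 (deserialize' p.1).2) := by
  have hl : CodeFP (pairE (listE natE) unE) (rawE natE) (fun p => p.1) := (rawOfList natE).comp (fst _ _)
  have hdes : CodeFP (pairE (listE natE) unE) (pairE bitE (pairE natE (pairE wireE (rawE gateE)))) (fun p => deserialize' p.1) :=
    (deserialize'_code.comp hl).congr fun _ => rfl
  have hctx : CodeFP (pairE (listE natE) unE) convInE (fun p => (p.2, (deserialize' p.1).2.1, (deserialize' p.1).2.2.1,
      (deserialize' p.1).2.2.2)) :=
    ((snd _ _).pair (hdes.snd'.fst'.pair (hdes.snd'.snd'.fst'.pair hdes.snd'.snd'.snd'))).congr fun _ => rfl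
  exact ((listOfRaw natE).comp ((convCodeB_code d m).comp hctx)).congr fun _ => rfl

end BT

end Literature.Computability.Complexity
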